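import Mathlib
import Summits.CriticalPhenomena.CardyFormulaZ2.Theorems.CardyMagicRigidityNestingRigidityConeTiltLoopSide
import Literature.Probability.Percolation.SiteNestingWeightIntegrable
import Literature.Probability.Percolation.NestingPhaseEstimates
import HarnessLib

/-!
# Pathwise UV split of the loop functional `A_f` (line `Sketch` v6, stub `stub_uvSplit`, S4a)

Crux `Summit.CriticalPhenomena.CardyFormulaZ2.Theses.CardyMagicRigidity.MagicFormulaT`
(stmt-CriticalPhenomena-4836), line `Sketch`, registered skeleton v6 (the UV split), stub `stub_uvSplit`
(S4a, "pathwise UV split of the loop functional + top bound", both lattice ensembles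
`E ∈ latticeEnsembles = {zEns, tEns}`).

For an admissible density `f` (`f = 0` off `B̄(0, R)`, `∫ f = 0`; the hypotheses `Measurable f`,
`|f| ≤ C`, `0 < η` of the registered signature are not used), a mesh `δ > 0`, cut-offs `η ≤ r` and a
configuration `c = E.X δ ω`, writing `w_u = 2cos(∫_{int u} f + π/3)` (`UnbasedLoop.nestingFactor`):

* `A_f(c) = A^{≥η}_f(c) · ∏_{u ∈ c, diam u < η} w_u` (the full functional splits off the small loops);
* `A^{≥η}_f(c) = A^{≥r}_f(c) · ∏_{u ∈ c, η ≤ diam u < r} w_u` (the band `[η, r)` splits off);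
* `|A^{≥r}_f(c)| ≤ 2 ^ #{u ∈ c | u meets B̄(0, R), diam u ≥ r}` (the top bound).

Proof.  A loop with `w_u ≠ 1` meets `B̄(0, R)` (`range_inter_closedBall_nonempty_of_nestingFactor_ne_one`,
Literature `NestingPhaseEstimates`), and on both lattices at mesh `δ > 0` only finitely many loops meet
that ball (`ConeTilt.finite_loops_meeting`, …`NestingRigidityConeTiltLoopSide`); so every `finprod` is an
honest finite product and `finprod_mem_union'` (finiteness of `s ∩ mulSupport`, not of `s`) splits it
along the disjoint decompositions `c.loops = c.bigLoops η ⊔ {diam < η}` and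
`c.bigLoops η = c.bigLoops r ⊔ {η ≤ diam < r}` (`η ≤ r`).  The top bound is `abs_finprod_mem_le_two_pow`
(Literature `SiteNestingWeightIntegrable`) with `|w_u| ≤ 2` (`UnbasedLoop.abs_nestingFactor_le`).

No named facts are used; everything is proved tree / Mathlib material.
-/

noncomputable section

namespace Summit.CriticalPhenomena.CardyFormulaZ2.Cruxes.MagicFormulaT.LineSketch

open MeasureTheory Filter Set
open scoped Real Topology BigOperators
open Literature.Probability.RandomPlanarGeometry Literature.Probability.Percolation
  Literature.Probability.LatticeModels
open Summit.CriticalPhenomena.CardyFormulaZ2.Cruxes.NestingRigidity.RingCloudTomography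

/-! ## Disjoint decompositions of the loop families by diameter -/

/-- `c.loops = c.bigLoops η ∪ {u ∈ c.loops | diam u < η}`. -/
theorem uvs_loops_eq_bigLoops_union (c : LoopConfig ℂ) (η : ℝ) :
    c.loops = c.bigLoops η ∪ {u ∈ c.loops | Metric.diam u.range < η} := by
  ext u
  simp only [LoopConfig.mem_bigLoops_iff, Set.mem_union, Set.mem_setOf_eq]
  constructor
  · intro hu
    rcases le_or_gt η (Metric.diam u.range) with h | h
    · exact Or.inl ⟨hu, h⟩
    · exact Or.inr ⟨hu, h⟩
  · rintro (⟨hu, _⟩ | ⟨hu, _⟩) <;> exact hu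

/-- The big loops (`η ≤ diam`) and the small loops (`diam < η`) are disjoint families. -/
theorem uvs_disjoint_bigLoops_small (c : LoopConfig ℂ) (η : ℝ) :
    Disjoint (c.bigLoops η) {u ∈ c.loops | Metric.diam u.range < η} :=
  Set.disjoint_left.2 fun _ hu hu' ↦ (not_lt.2 hu.2) hu'.2

/-- For `η ≤ r`: `c.bigLoops η = c.bigLoops r ∪ {u ∈ c.loops | η ≤ diam u ∧ diam u < r}`. -/
theorem uvs_bigLoops_eq_bigLoops_union_band (c : LoopConfig ℂ) {η r : ℝ} (hηr : η ≤ r) :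
    c.bigLoops η =
      c.bigLoops r ∪ {u ∈ c.loops | η ≤ Metric.diam u.range ∧ Metric.diam u.range < r} := by
  ext u
  simp only [LoopConfig.mem_bigLoops_iff, Set.mem_union, Set.mem_setOf_eq]
  constructor
  · rintro ⟨hu, hη⟩
    rcases le_or_gt r (Metric.diam u.range) with h | h
    · exact Or.inl ⟨hu, h⟩
    · exact Or.inr ⟨hu, hη, h⟩
  · rintro (⟨hu, h⟩ | ⟨hu, hη, _⟩)
    · exact ⟨hu, hηr.trans h⟩
    · exact ⟨hu, hη⟩

/-- The loops of diameter `≥ r` and the band `[η, r)` are disjoint families. -/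
theorem uvs_disjoint_bigLoops_band (c : LoopConfig ℂ) (η r : ℝ) :
    Disjoint (c.bigLoops r)
      {u ∈ c.loops | η ≤ Metric.diam u.range ∧ Metric.diam u.range < r} :=
  Set.disjoint_left.2 fun _ hu hu' ↦ (not_lt.2 hu.2) hu'.2.2

/-! ## Only the finitely many loops meeting `B̄(0, R)` contribute -/

/-- If finitely many loops of `c` meet `B̄(0, R)` and `f` is admissible (`f = 0` off `B̄(0, R)`,
`∫ f = 0`), then on every sub-family `S ⊆ c.loops` only finitely many weights `w_u` differ from `1`. -/
theorem uvs_finite_inter_mulSupport {c : LoopConfig ℂ} {f : ℂ → ℝ} {R : ℝ}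
    (hfin : {u ∈ c.loops | (u.range ∩ Metric.closedBall (0 : ℂ) R).Nonempty}.Finite)
    (hR : ∀ z, R < ‖z‖ → f z = 0) (h0 : ∫ z, f z = 0) {S : Set (UnbasedLoop ℂ)}
    (hS : S ⊆ c.loops) :
    (S ∩ Function.mulSupport fun u : UnbasedLoop ℂ ↦ u.nestingFactor f).Finite :=
  hfin.subset fun _ hu ↦
    ⟨hS hu.1, range_inter_closedBall_nonempty_of_nestingFactor_ne_one hR h0 hu.2⟩

/-! ## The registered stub -/

/-- **Stub S4a (`UVSplit`, pathwise; both lattices).**  For `E ∈ latticeEnsembles`, an admissible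
density `f` (`f = 0` off `B̄(0, R)`, `∫ f = 0`), a mesh `δ > 0`, cut-offs `η ≤ r` and every `ω`:
`A_f = A^{≥η}_f · ∏_{diam < η} w_u`, `A^{≥η}_f = A^{≥r}_f · ∏_{η ≤ diam < r} w_u`, and
`|A^{≥r}_f| ≤ 2 ^ #{loops meeting B̄(0, R) of diameter ≥ r}`.  The loops with factor `≠ 1` meet
`B̄(0, R)` (`nestingFactor_eq_one_of_disjoint`), finitely many (`ConeTilt.finite_loops_meeting`), so
every `finprod` is an honest finite product and splits along the disjoint diameter classes
(`finprod_mem_union'`); `|w| ≤ 2` (`abs_nestingFactor_le`) and `abs_finprod_mem_le_two_pow` give the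
top bound. -/
theorem stub_uvSplit : ∀ E ∈ latticeEnsembles, ∀ (f : ℂ → ℝ) (R C : ℝ), Measurable f → (∀ z, |f z| ≤ C) →
    (∀ z, R < ‖z‖ → f z = 0) → ∫ z, f z = 0 →
    ∀ (δ η r : ℝ), 0 < δ → 0 < η → η ≤ r → ∀ ω : E.Ω,
      (E.X δ ω).nestingWeight f =
        (E.X δ ω).truncNestingWeight f η *
          ∏ᶠ u ∈ {u ∈ (E.X δ ω).loops | Metric.diam u.range < η}, u.nestingFactor f ∧
      (E.X δ ω).truncNestingWeight f η =
        (E.X δ ω).truncNestingWeight f r *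
          ∏ᶠ u ∈ {u ∈ (E.X δ ω).loops | η ≤ Metric.diam u.range ∧ Metric.diam u.range < r},
            u.nestingFactor f ∧
      |(E.X δ ω).truncNestingWeight f r| ≤
        (2 : ℝ) ^ {u ∈ (E.X δ ω).loops | (u.range ∩ Metric.closedBall (0 : ℂ) R).Nonempty ∧
          r ≤ Metric.diam u.range}.ncard := by
  intro E hE f R C _ _ hR h0 δ η r hδ _ hηr ω
  have hfin : {u ∈ (E.X δ ω).loops | (u.range ∩ Metric.closedBall (0 : ℂ) R).Nonempty}.Finite :=
    ConeTilt.finite_loops_meeting E hE hδ ω R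
  refine ⟨?_, ?_, ?_⟩
  · -- `A_f = A^{≥η}_f · ∏_{diam < η} w_u`
    have h := finprod_mem_union' (f := fun u : UnbasedLoop ℂ ↦ u.nestingFactor f)
      (uvs_disjoint_bigLoops_small (E.X δ ω) η)
      (uvs_finite_inter_mulSupport hfin hR h0 (LoopConfig.bigLoops_subset_loops η _))
      (uvs_finite_inter_mulSupport hfin hR h0 (Set.sep_subset _ _))
    rw [← uvs_loops_eq_bigLoops_union (E.X δ ω) η] at h
    simpa only [LoopConfig.nestingWeight, LoopConfig.truncNestingWeight] using h
  · -- `A^{≥η}_f = A^{≥r}_f · ∏_{η ≤ diam < r} w_u`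
    have h := finprod_mem_union' (f := fun u : UnbasedLoop ℂ ↦ u.nestingFactor f)
      (uvs_disjoint_bigLoops_band (E.X δ ω) η r)
      (uvs_finite_inter_mulSupport hfin hR h0 (LoopConfig.bigLoops_subset_loops r _))
      (uvs_finite_inter_mulSupport hfin hR h0 (Set.sep_subset _ _))
    rw [← uvs_bigLoops_eq_bigLoops_union_band (E.X δ ω) hηr] at h
    simpa only [LoopConfig.truncNestingWeight] using h
  · -- the top bound: `|A^{≥r}_f| ≤ 2 ^ #{loops meeting B̄(0, R) of diameter ≥ r}`
    have hT : {u ∈ (E.X δ ω).loops | (u.range ∩ Metric.closedBall (0 : ℂ) R).Nonempty ∧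
        r ≤ Metric.diam u.range}.Finite :=
      hfin.subset fun u hu ↦ ⟨hu.1, hu.2.1⟩
    have hsupp : ((E.X δ ω).bigLoops r ∩
        Function.mulSupport fun u : UnbasedLoop ℂ ↦ u.nestingFactor f) ⊆
          {u ∈ (E.X δ ω).loops | (u.range ∩ Metric.closedBall (0 : ℂ) R).Nonempty ∧
            r ≤ Metric.diam u.range} := fun u hu ↦
      ⟨hu.1.1, range_inter_closedBall_nonempty_of_nestingFactor_ne_one hR h0 hu.2, hu.1.2⟩
    rw [LoopConfig.truncNestingWeight]
    exact abs_finprod_mem_le_two_pow (fun u ↦ UnbasedLoop.abs_nestingFactor_le f u) hT hsupp le_rfl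

end Summit.CriticalPhenomena.CardyFormulaZ2.Cruxes.MagicFormulaT.LineSketch

end
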